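import Summits.ValiantsHypothesis.ValiantsHypothesis.Theorems.KPlusLogSqLawTropicalBSingleGaugeLevelMajor

/-!
# Route «KPlusLogSqLaw», crux `TropicalB` (stmt-ValiantsHypothesis-19771) — SINGLE-GAUGE LAW SHARPENED FOR GENERIC GAUGES:
# a chain certified by one affine row gauge with pairwise distinct gauged slopes has `n ≤ (K−1)·m²`

HONEST FRAMING.  Helper `--supports` the crux `Summit.ValiantsHypothesis.ValiantsHypothesis.Theses.KPlusLogSqLaw.TropicalB`
(item stmt-ValiantsHypothesis-19771, route KPlusLogSqLaw, DRAFT; cell `pub-symmetroid`, seat val-sym-trop-p5 g11, 2026-08-27).  A STRUCTURE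
theorem on dominant chains of ARBITRARY designs admitting a column-wise certificate by ONE affine row gauge (the class of the tree's
SINGLE-GAUGE LAW `SingleGauge.chain_le_of_singleGauge`, p554764: `n ≤ m(mK − 1)`), under the genericity hypothesis that the `mK` gauged slopes
`d_l − α_i` are pairwise distinct and `d 0` is a least exponent.  Nothing here bears on `TropicalB` in its window, `WeakLifting`, the doors,
`MatrixDescartes` (stmt-ValiantsHypothesis-18050) or VP ≠ VNP.

* `chain_le_of_genericGauge` — **such a chain has `n ≤ m · #{(i,l) : l ≠ 0} = (K−1)·m²`** (for `K = 4`: `3m²` against `4m² − m`).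
Proof = the COUNTING potential `ψ(i,l) = #{incidence types (i₂,l₂) with l₂ ≠ 0 and strictly larger gauged slope}`: along a certified column
the gauged slope never decreases (`gslope_mono` of the level-major file), so `ψ` never increases; in every step some changed column moves to a
row of no smaller `α` (`Σ α` over a permutation is constant) or relabels, hence to a strictly larger exponent `d_{l'} > d_l ≥ d_0`, i.e. to a
type `(i',l')` with `l' ≠ 0` that `ψ` counted before and not after: `Φ_{k+1} ≤ Φ_k − 1`, `0 ≤ Φ ≤ m·#{l ≠ 0 types}`.
[this seat.  Located companion (memo SINGLE-GAUGE-CEILING-g11 on the item, NOT claimed here): the finer potential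
`#{types of the MIDDLE classes after} + [class ≤ K−2]` certifies `n ≤ (K−2)m² + m` on every linear extension for `m ≤ 4` (exhaustive) and
sampled `m ≤ 7`; the located single-gauge maximum is DIAMOND's `(K−3)m² + 2m`.]
-/

set_option linter.dupNamespace false
set_option autoImplicit false

namespace Summit.ValiantsHypothesis.ValiantsHypothesis.Theorems.KPlusLogSqLaw

open Summit.ValiantsHypothesis.ValiantsHypothesis.Theorems.MatrixDescartes.Negative
open scoped BigOperators
open Finset

namespace SingleGauge

variable {m K : ℕ}

/-- **SINGLE-GAUGE LAW, GENERIC GAUGE.**  A dominant chain with distinct consecutive terms, certified column-wise at every time by ONE affine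
row gauge (hypothesis `hcert` verbatim of `chain_le_of_singleGauge`) whose gauged slopes `d_l − α_i` are pairwise distinct over the incidence
types `(i, l)` (`hgen`) and with `d 0` a least exponent (`hd0`), has `n ≤ m · #{(i,l) : l ≠ 0}` — i.e. `n ≤ (K−1)·m²` — against the tree's
`m(mK − 1)`. [this seat; counting potential] -/
theorem chain_le_of_genericGauge (d : Fin K → ℕ) (v ε : Fin m → Fin m → Fin K → ℤ) (α β : Fin m → ℚ)
    (hgen : ∀ (i i' : Fin m) (l l' : Fin K), (d l : ℚ) - α i = (d l' : ℚ) - α i' → i = i' ∧ l = l')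
    (l₀ : Fin K) (hd0 : ∀ l, d l₀ ≤ d l)
    {n : ℕ} (θ : Fin (n + 1) → ℤ) (hθ : StrictMono θ) (p : Fin (n + 1) → Equiv.Perm (Fin m) × (Fin m → Fin K))
    (hdom : ∀ k, IsDominant d v ε (θ k) (p k)) (hne : ∀ k : Fin n, p k.castSucc ≠ p k.succ)
    (hcert : ∀ (k : Fin (n + 1)) (j i : Fin m) (l : Fin K), ε i j l ≠ 0 →
      ((θ k : ℚ) * (d l : ℚ) - (v i j l : ℚ)) - (α i * (θ k : ℚ) + β i) ≤
        ((θ k : ℚ) * (d ((p k).2 j) : ℚ) - (v ((p k).1 j) j ((p k).2 j) : ℚ)) - (α ((p k).1 j) * (θ k : ℚ) + β ((p k).1 j))) :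
    n ≤ m * (univ.filter fun il : Fin m × Fin K => il.2 ≠ l₀).card := by
  -- the counting potential
  let S : Finset (Fin m × Fin K) := univ.filter fun il : Fin m × Fin K => il.2 ≠ l₀
  let g : Fin m → Fin K → ℚ := fun i l => (d l : ℚ) - α i
  let P : Fin m → Fin K → ℤ := fun i l => ((S.filter fun il => g i l < g il.1 il.2).card : ℤ)
  have hPle : ∀ i l, P i l ≤ (S.card : ℤ) := fun i l => by
    simp only [P]; exact_mod_cast card_le_card (filter_subset _ _)
  have hPnn : ∀ i l, 0 ≤ P i l := fun i l => by positivity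
  -- monotone: larger gauged slope ⇒ P does not increase; strictly if the new type has class ≠ l₀
  have hPmono : ∀ i l i' l', g i l < g i' l' → P i' l' ≤ P i l ∧ (l' ≠ l₀ → P i' l' + 1 ≤ P i l) := by
    intro i l i' l' hlt
    have hsub : (S.filter fun il => g i' l' < g il.1 il.2) ⊆ (S.filter fun il => g i l < g il.1 il.2) := by
      intro il hil; rw [mem_filter] at hil ⊢; exact ⟨hil.1, hlt.trans hil.2⟩
    refine ⟨by simp only [P]; exact_mod_cast card_le_card hsub, fun hl' => ?_⟩
    have hss : (S.filter fun il => g i' l' < g il.1 il.2) ⊂ (S.filter fun il => g i l < g il.1 il.2) := by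
      rw [ssubset_iff_of_subset hsub]
      refine ⟨(i', l'), ?_, ?_⟩
      · rw [mem_filter]; exact ⟨by rw [mem_filter]; exact ⟨mem_univ _, hl'⟩, hlt⟩
      · rw [mem_filter]; exact fun h => lt_irrefl _ h.2
    have := card_lt_card hss
    simp only [P]; omega
  let Φ : Fin (n + 1) → ℤ := fun k => ∑ j, P ((p k).1 j) ((p k).2 j)
  have hstep : ∀ k : Fin n, Φ k.succ + 1 ≤ Φ k.castSucc := by
    intro k
    set a := k.castSucc with ha
    set b := k.succ with hb
    have hab : θ a < θ b := hθ (Fin.castSucc_lt_succ (i := k))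
    have habQ : (θ a : ℚ) < (θ b : ℚ) := by exact_mod_cast hab
    have hcol : ∀ j, P ((p b).1 j) ((p b).2 j) ≤ P ((p a).1 j) ((p a).2 j) ∧
        (((p a).1 j ≠ (p b).1 j ∨ (p a).2 j ≠ (p b).2 j) → α ((p a).1 j) ≤ α ((p b).1 j) →
          P ((p b).1 j) ((p b).2 j) + 1 ≤ P ((p a).1 j) ((p a).2 j)) := by
      intro j
      have e1 := eps_ne_zero_of_isDominant (hdom a) j
      have e2 := eps_ne_zero_of_isDominant (hdom b) j
      have c1 := hcert a j ((p b).1 j) ((p b).2 j) e2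
      have c2 := hcert b j ((p a).1 j) ((p a).2 j) e1
      have hmono : g ((p a).1 j) ((p a).2 j) ≤ g ((p b).1 j) ((p b).2 j) := by
        show (d ((p a).2 j) : ℚ) - α ((p a).1 j) ≤ (d ((p b).2 j) : ℚ) - α ((p b).1 j)
        nlinarith
      by_cases hch : (p a).1 j ≠ (p b).1 j ∨ (p a).2 j ≠ (p b).2 j
      · have hlt : g ((p a).1 j) ((p a).2 j) < g ((p b).1 j) ((p b).2 j) := by
          refine lt_of_le_of_ne hmono fun heq => ?_
          obtain ⟨h1, h2⟩ := hgen _ _ _ _ heq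
          rcases hch with h | h
          · exact h h1
          · exact h h2
        obtain ⟨d0, d1⟩ := hPmono _ _ _ _ hlt
        refine ⟨d0, fun _ hle => d1 ?_⟩
        -- new class is not the least one: its exponent strictly exceeds the old one
        intro hl0
        have hlt' : (d ((p a).2 j) : ℚ) - α ((p a).1 j) < (d ((p b).2 j) : ℚ) - α ((p b).1 j) := hlt
        have h0 : (d ((p b).2 j) : ℚ) ≤ (d ((p a).2 j) : ℚ) := by rw [hl0]; exact_mod_cast hd0 _
        linarith
      · push Not at hch
        obtain ⟨h1, h2⟩ := hch
        rw [h1, h2]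
        exact ⟨le_rfl, fun hc _ => by rcases hc with hc | hc <;> exact absurd rfl hc⟩
    have hex : ∃ j, ((p a).1 j ≠ (p b).1 j ∨ (p a).2 j ≠ (p b).2 j) ∧ α ((p a).1 j) ≤ α ((p b).1 j) := by
      by_cases hrow : ∃ j, (p a).1 j ≠ (p b).1 j
      · have hsum : ∑ j, α ((p a).1 j) = ∑ j, α ((p b).1 j) := by
          rw [Equiv.sum_comp (p a).1 α, Equiv.sum_comp (p b).1 α]
        by_contra hcon
        push Not at hcon
        have hle : ∀ j, α ((p b).1 j) ≤ α ((p a).1 j) := by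
          intro j
          by_cases hj : (p a).1 j = (p b).1 j
          · rw [hj]
          · exact (hcon j (Or.inl hj)).le
        obtain ⟨j0, hj0⟩ := hrow
        have hlt0 : α ((p b).1 j0) < α ((p a).1 j0) := hcon j0 (Or.inl hj0)
        have : ∑ j, α ((p b).1 j) < ∑ j, α ((p a).1 j) :=
          sum_lt_sum (fun j _ => hle j) ⟨j0, mem_univ _, hlt0⟩
        linarith
      · push Not at hrow
        have hperm : (p a).1 = (p b).1 := Equiv.ext hrow
        have hcls : (p a).2 ≠ (p b).2 := by
          intro hc
          exact hne k (Prod.ext hperm hc)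
        obtain ⟨j, hj⟩ := Function.ne_iff.mp hcls
        exact ⟨j, Or.inr hj, by rw [hrow j]⟩
    obtain ⟨j0, hj0c, hj0a⟩ := hex
    have h0 : P ((p b).1 j0) ((p b).2 j0) + 1 ≤ P ((p a).1 j0) ((p a).2 j0) := (hcol j0).2 hj0c hj0a
    have hge : (P ((p a).1 j0) ((p a).2 j0) - P ((p b).1 j0) ((p b).2 j0)) ≤
        ∑ j, (P ((p a).1 j) ((p a).2 j) - P ((p b).1 j) ((p b).2 j)) :=
      single_le_sum (f := fun j => P ((p a).1 j) ((p a).2 j) - P ((p b).1 j) ((p b).2 j))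
        (fun j _ => by linarith [(hcol j).1]) (mem_univ j0)
    have hdiff : Φ a - Φ b = ∑ j, (P ((p a).1 j) ((p a).2 j) - P ((p b).1 j) ((p b).2 j)) := by
      simp only [Φ, sum_sub_distrib]
    linarith
  have htel : ∀ k : Fin (n + 1), Φ k + (k : ℤ) ≤ Φ 0 := by
    intro k
    induction k using Fin.induction with
    | zero => simp
    | succ k ih =>
      have := hstep k
      have hv : ((k.succ : Fin (n + 1)) : ℤ) = ((k.castSucc : Fin (n + 1)) : ℤ) + 1 := by
        simp [Fin.val_succ]
      rw [hv]; linarith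
  have hlast := htel (Fin.last n)
  have h0 : Φ 0 ≤ (m : ℤ) * (S.card : ℤ) := by
    calc Φ 0 = ∑ j, P ((p 0).1 j) ((p 0).2 j) := rfl
      _ ≤ ∑ _j : Fin m, (S.card : ℤ) := sum_le_sum fun j _ => hPle _ _
      _ = (m : ℤ) * (S.card : ℤ) := by rw [sum_const, card_univ, Fintype.card_fin]; ring
  have hnn : 0 ≤ Φ (Fin.last n) := sum_nonneg fun j _ => hPnn _ _
  have hl : ((Fin.last n : Fin (n + 1)) : ℤ) = n := by simp
  rw [hl] at hlast
  have : (n : ℤ) ≤ (m : ℤ) * (S.card : ℤ) := by linarith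
  exact_mod_cast this

/-- the count of incidence types with class different from a fixed one: `m·(K−1)`. -/
theorem card_types_ne (l₀ : Fin K) : (univ.filter fun il : Fin m × Fin K => il.2 ≠ l₀).card = m * (K - 1) := by
  have : (univ.filter fun il : Fin m × Fin K => il.2 ≠ l₀) = (univ : Finset (Fin m)) ×ˢ (univ.erase l₀) := by
    ext ⟨i, l⟩; simp [mem_product]
  rw [this, card_product, card_univ, Fintype.card_fin, card_erase_of_mem (mem_univ _), card_univ, Fintype.card_fin]

/-- **Corollary (format form).**  Under the hypotheses of `chain_le_of_genericGauge`: `n ≤ (K−1)·m²`. -/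
theorem chain_le_of_genericGauge' (d : Fin K → ℕ) (v ε : Fin m → Fin m → Fin K → ℤ) (α β : Fin m → ℚ)
    (hgen : ∀ (i i' : Fin m) (l l' : Fin K), (d l : ℚ) - α i = (d l' : ℚ) - α i' → i = i' ∧ l = l')
    (l₀ : Fin K) (hd0 : ∀ l, d l₀ ≤ d l)
    {n : ℕ} (θ : Fin (n + 1) → ℤ) (hθ : StrictMono θ) (p : Fin (n + 1) → Equiv.Perm (Fin m) × (Fin m → Fin K))
    (hdom : ∀ k, IsDominant d v ε (θ k) (p k)) (hne : ∀ k : Fin n, p k.castSucc ≠ p k.succ)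
    (hcert : ∀ (k : Fin (n + 1)) (j i : Fin m) (l : Fin K), ε i j l ≠ 0 →
      ((θ k : ℚ) * (d l : ℚ) - (v i j l : ℚ)) - (α i * (θ k : ℚ) + β i) ≤
        ((θ k : ℚ) * (d ((p k).2 j) : ℚ) - (v ((p k).1 j) j ((p k).2 j) : ℚ)) - (α ((p k).1 j) * (θ k : ℚ) + β ((p k).1 j))) :
    n ≤ (K - 1) * m ^ 2 := by
  have h := chain_le_of_genericGauge d v ε α β hgen l₀ hd0 θ hθ p hdom hne hcert
  rw [card_types_ne] at h
  calc n ≤ m * (m * (K - 1)) := h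
    _ = (K - 1) * m ^ 2 := by ring

end SingleGauge

end Summit.ValiantsHypothesis.ValiantsHypothesis.Theorems.KPlusLogSqLaw
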